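import Literature.AlgebraicGeometry.Motives.HypersurfaceCharts
import Literature.NumberTheory.EllipticCurves.WeierstrassSchemeCharts
import Literature.NumberTheory.EllipticCurves.WeierstrassSchemePoints
import HarnessLib

/-!
# The hypersurface-chart presentation of the two charts of the Weierstrass cubic

For a Weierstrass curve `W` over a field `K` and its plane cubic `E_W = V₊(F) ⊂ ℙ²_K`
(`WeierstrassCurve.scheme`), the two affine charts `E_W ∩ D₊(Z)` (`aff`) and `E_W ∩ D₊(Y)` (`inf`)
are set up in `EllipticCurves/WeierstrassSchemeCharts` (index type `ChartIdx`, explicit coordinate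
rings `ChartRing W c = K[y₀, y₁]/(F(x_{c.i} := 1))`, open immersions `chartMap W c`, the cover
`mem_range_infChart_or_affineChart`, the universal property `chartRingLift` into any `K`-algebra).
**That presentation is the canonical one for the two charts of `E_W`.** The construction of the
addition morphism `E_W × E_W → E_W` from addition-law *vectors* (`WeierstrassSchemeSquare` and sequels)
runs instead through the generic machinery of `Motives/HypersurfaceCharts` and
`Motives/ProjectiveSpaceRingPoints` (chart rings `A_i = K[x]_{(xᵢ)}/√(F/xᵢ³)` of any hypersurface,
vector-valued points `vecChartPoint`, `liftVec`), and this file is the **dictionary** between the two: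

* `W.chartRing i`, `W.chart i`, `W.tautVec i` (`i : Fin 3`): the hypersurface chart ring, the chart
  `Spec A_i → E_W` over `K` and the tautological solution vector `(xⱼ/xᵢ)ⱼ ∈ A_i³`
  (`equation_tautVec`), with `chart_schemeι` and `specOverOfAlgHom_liftVec_chart_schemeι`
  (the `S`-point of `E_W` defined by a solution vector is, in `ℙ²`, the point with those
  homogeneous coordinates);
* **the dictionary** `W.chartRingEquivChartRing c : W.chartRing c.i ≃+* ChartRing W c`
  (`c : ChartIdx`; the composite of `SmoothHypersurface.chartRingEquiv` and
  `WeierstrassScheme.chartRingEquiv`) and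
  `specMap_chartRingEquivChartRing_comp_chartLeft : Spec (≃) ≫ W.chartLeft c.i = chartMap W c` —
  the two charts are the *same* open immersion up to this ring isomorphism; consequently
  (transported from the sibling, not re-proved) the hypersurface chart rings of `aff`, `inf` are
  domains for every `W` (`isDomain_chartRing`), have the same images (`range_chartLeft`) and cover
  `E_W` (`exists_mem_chart_range`, `chartCover`).

## References

* [SilvermanAEC2009] J. H. Silverman, *AEC*, 2nd ed.: III.1.
* [Hartshorne1977] R. Hartshorne, *Algebraic Geometry*: II Prop. 2.5, II Prop. 5.9.

## Design notes

Dot-notation extensions of Mathlib's `WeierstrassCurve` in `namespace WeierstrassCurve`; the chart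
index is the sibling's `WeierstrassScheme.ChartIdx` (`aff ↦ 2`, `inf ↦ 1`); `K : Type u`.
-/

noncomputable section

open CategoryTheory AlgebraicGeometry MvPolynomial HomogeneousLocalization
open Literature.AlgebraicGeometry.Motives Literature.AlgebraicGeometry.Motives.SmoothHypersurface
open Literature.NumberTheory.EllipticCurves
open Literature.NumberTheory.EllipticCurves.WeierstrassScheme (ChartIdx chartMap)
open scoped WeierstrassCurve.Projective

universe u

namespace WeierstrassCurve

variable {K : Type u} [Field K] (W : WeierstrassCurve K)

attribute [local instance] MvPolynomial.gradedAlgebra ProjBaseChange.algebraBase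

/-! ### The hypersurface chart rings and charts -/

/-- **The hypersurface chart ring `A_i = K[x]_{(xᵢ)}/√(F/xᵢ³)` of `E_W ∩ D₊(xᵢ)`**
(`Motives/HypersurfaceCharts.ChartRing` for the Weierstrass cubic). [folklore] -/
abbrev chartRing (i : Fin 3) : Type u :=
  ChartRing (n := 1) W.toProjective.polynomial i W.toProjective.isHomogeneous_polynomial

/-- **The chart `Spec A_i → E_W`** over `K` (an open immersion onto `E_W ∩ D₊(xᵢ)`). [folklore] -/
abbrev chart (i : Fin 3) : specOver K (W.chartRing i) ⟶ W.scheme :=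
  SmoothHypersurface.chart (n := 1) W.toProjective.polynomial i
    W.toProjective.isHomogeneous_polynomial three_pos

/-- The quotient map `K[x]_{(xᵢ)} → A_i`. [folklore] -/
abbrev toChartRing (i : Fin 3) :
    Away (MvPolynomial.homogeneousSubmodule (Fin 3) K) (X i) →ₐ[K] W.chartRing i :=
  SmoothHypersurface.toChartRing (n := 1) W.toProjective.polynomial i
    W.toProjective.isHomogeneous_polynomial

/-- **The tautological vector** `(xⱼ/xᵢ)ⱼ ∈ A_i³`. [folklore] -/
abbrev tautVec (i : Fin 3) : Fin 3 → W.chartRing i :=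
  SmoothHypersurface.tautVec (n := 1) W.toProjective.polynomial i W.toProjective.isHomogeneous_polynomial

/-- `Spec A_i → E_W` is an open immersion. [folklore] -/
instance isOpenImmersion_chart_left (i : Fin 3) : IsOpenImmersion (W.chart i).left :=
  SmoothHypersurface.isOpenImmersion_chart_left _ i _ three_pos

/-- The chart `Spec A_i → E_W` as a morphism of schemes with source written `Spec A_i` (the form in
which Mathlib's `Spec`/pullback lemmas rewrite; `rfl` to `(W.chart i).left`). [folklore] -/
abbrev chartLeft (i : Fin 3) : Spec (.of (W.chartRing i)) ⟶ W.scheme.left := (W.chart i).left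

/-- `Spec A_i → E_W` is an open immersion (scheme-level form). [folklore] -/
instance isOpenImmersion_chartLeft (i : Fin 3) : IsOpenImmersion (W.chartLeft i) :=
  W.isOpenImmersion_chart_left i

/-- `Spec A_i → E_W → Spec K` is `Spec (K → A_i)`. [folklore] -/
theorem chartLeft_comp_hom (i : Fin 3) :
    W.chartLeft i ≫ W.scheme.hom = Spec.map (CommRingCat.ofHom (algebraMap K (W.chartRing i))) :=
  Over.w (W.chart i)

/-- `chartLeft` is `Spec (A_i ≅ Γ(D₊(xᵢ))/𝓘) ≫ (Mathlib's affine piece of the closed subscheme)`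
(`rfl`). [folklore] -/
theorem chartLeft_eq (i : Fin 3) :
    W.chartLeft i =
      Spec.map (SmoothHypersurface.chartRingEquiv (n := 1) W.toProjective.polynomial i
          W.toProjective.isHomogeneous_polynomial three_pos).toCommRingCatIso.inv ≫
        ProjSubscheme.subschemePiece (SmoothHypersurface.idealSheaf W.toProjective.polynomial)
          (coordChartOpen K i) :=
  rfl

/-- The image of `Spec A_i → E_W` is `E_W ∩ D₊(xᵢ)`. [folklore] -/
theorem opensRange_chart_left (i : Fin 3) :
    (W.chart i).left.opensRange =
      W.schemeι.left ⁻¹ᵁ Proj.basicOpen (MvPolynomial.homogeneousSubmodule (Fin 3) K) (X i) :=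
  SmoothHypersurface.opensRange_chart_left _ i _ three_pos

/-- `Spec A_i → E_W ↪ ℙ²_K` is `Spec (K[x]_{(xᵢ)} → A_i)` followed by `D₊(xᵢ) ↪ ℙ²_K`
(`Motives/HypersurfaceCharts.chart_hypersurfaceι` for `E_W`). [folklore] -/
theorem chart_schemeι (i : Fin 3) :
    W.chart i ≫ W.schemeι =
      specOverOfAlgHom (W.toChartRing i) ≫ ProjectiveSpace.awayChartι (ProjectiveSpace.X_mem i) one_pos :=
  SmoothHypersurface.chart_hypersurfaceι _ i _ three_pos

/-- **The `S`-point of `E_W` defined by a solution vector `v` with unit `i`-th coordinate is, in `ℙ²_K`,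
the point with homogeneous coordinates `v`** (`Motives/HypersurfaceCharts.specOverOfAlgHom_liftVec_chart_hypersurfaceι`
for `E_W`). [folklore] -/
theorem specOverOfAlgHom_liftVec_chart_schemeι (i : Fin 3) {S : Type u} [CommRing S] [Algebra K S]
    [IsReduced S] (v : Fin 3 → S) (hv : IsUnit (aeval v (X i : MvPolynomial (Fin 3) K)))
    (hFv : aeval v W.toProjective.polynomial = 0) :
    specOverOfAlgHom (liftVec (n := 1) W.toProjective.polynomial i W.toProjective.isHomogeneous_polynomial
        v hv hFv) ≫ W.chart i ≫ W.schemeι =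
      ProjectiveSpace.vecChartPoint (ProjectiveSpace.X_mem i) one_pos v hv :=
  specOverOfAlgHom_liftVec_chart_hypersurfaceι _ i _ three_pos v hv hFv

/-! ### The tautological vector solves the Weierstrass equation -/

/-- Evaluating the Weierstrass cubic of `W` at `v ∈ S³` (`S` a `K`-algebra) is evaluating the
Weierstrass cubic of `W_S` at `v`. [folklore] -/
theorem aeval_toProjective_polynomial_ring {S : Type u} [CommRing S] [Algebra K S] (v : Fin 3 → S) :
    aeval v W.toProjective.polynomial = eval v (W.baseChange S).toProjective.polynomial := by
  rw [aeval_def, show (W.baseChange S).toProjective = W.toProjective.map (algebraMap K S) from rfl,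
    Projective.map_polynomial, eval_map]

/-- `(tautVec i) i = 1`. [folklore] -/
theorem tautVec_self (i : Fin 3) : W.tautVec i i = 1 :=
  SmoothHypersurface.tautVec_self _ i _

/-- **The tautological vector lies on the curve**: it satisfies the homogeneous Weierstrass equation
over `A_i`. [folklore] -/
theorem equation_tautVec (i : Fin 3) :
    (W.baseChange (W.chartRing i)).toProjective.Equation (W.tautVec i) := by
  change eval (W.tautVec i) (W.baseChange (W.chartRing i)).toProjective.polynomial = 0
  rw [← aeval_toProjective_polynomial_ring]
  exact aeval_tautVec_eq_zero _ i _

/-! ### The dictionary with `WeierstrassSchemeCharts` -/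

/-- **`A_{c.i} ≃+* K[y₀, y₁]/(F(x_{c.i} := 1))`**: the hypersurface chart ring of the chart `c` is the
explicit chart ring of `WeierstrassSchemeCharts` — the composite of
`SmoothHypersurface.chartRingEquiv` (`A_i ≅ Γ(D₊(xᵢ))/𝓘`) and `WeierstrassScheme.chartRingEquiv`
(`Γ(D₊(xᵢ))/𝓘 ≅ K[y₀, y₁]/(F(xᵢ := 1))`). [folklore] -/
def chartRingEquivChartRing (c : ChartIdx) : W.chartRing c.i ≃+* WeierstrassScheme.ChartRing W c :=
  (SmoothHypersurface.chartRingEquiv (n := 1) W.toProjective.polynomial c.i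
      W.toProjective.isHomogeneous_polynomial three_pos).trans
    (WeierstrassScheme.chartRingEquiv W c.i (WeierstrassScheme.ChartIdx.prime W c))

set_option backward.isDefEq.respectTransparency false in
/-- **The two charts agree**: `Spec (A_{c.i} ≅ ChartRing W c) ≫ chartLeft c.i = chartMap W c`
(both are Mathlib's affine piece `subschemePiece 𝓘 D₊(x_{c.i})` precomposed with the respective ring
isomorphism). [folklore] -/
theorem specMap_chartRingEquivChartRing_comp_chartLeft (c : ChartIdx) :
    Spec.map (CommRingCat.ofHom (W.chartRingEquivChartRing c).toRingHom) ≫ W.chartLeft c.i = chartMap W c := by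
  rw [WeierstrassScheme.chartMap_def, WeierstrassScheme.chart_def, chartLeft_eq, ← Spec.map_comp_assoc]
  congr 2
  ext a
  change W.chartRingEquivChartRing c ((SmoothHypersurface.chartRingEquiv (n := 1) W.toProjective.polynomial c.i
      W.toProjective.isHomogeneous_polynomial three_pos).symm a) =
    WeierstrassScheme.chartRingEquiv W c.i (WeierstrassScheme.ChartIdx.prime W c) a
  rw [chartRingEquivChartRing, RingEquiv.trans_apply, RingEquiv.apply_symm_apply]

/-- **The hypersurface chart rings of `aff`, `inf` are domains**, for every Weierstrass curve over a
field (transported from `WeierstrassScheme.isDomain_chartRing`). [folklore] -/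
instance isDomain_chartRing (c : ChartIdx) : IsDomain (W.chartRing c.i) :=
  MulEquiv.isDomain (WeierstrassScheme.ChartRing W c) (W.chartRingEquivChartRing c).toMulEquiv

/-- The two presentations of the chart `c` have the same image in `E_W`. [folklore] -/
theorem range_chartLeft (c : ChartIdx) : Set.range (W.chartLeft c.i) = Set.range (chartMap W c) := by
  haveI : IsIso (Spec.map (CommRingCat.ofHom (W.chartRingEquivChartRing c).toRingHom)) :=
    inferInstanceAs (IsIso (Spec.map (W.chartRingEquivChartRing c).toCommRingCatIso.hom))
  have hs : Function.Surjective (Spec.map (CommRingCat.ofHom (W.chartRingEquivChartRing c).toRingHom)) :=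
    (Scheme.homeoOfIso (asIso (Spec.map (CommRingCat.ofHom (W.chartRingEquivChartRing c).toRingHom)))).surjective
  rw [← specMap_chartRingEquivChartRing_comp_chartLeft, Scheme.Hom.comp_base, TopCat.coe_comp, Set.range_comp,
    hs.range_eq, Set.image_univ]

/-- **Every point of `E_W` lies in the chart `aff` or `inf`** (the cover
`WeierstrassScheme.mem_range_infChart_or_affineChart`, read for the hypersurface charts).
[cite: SilvermanAEC2009, III.1] -/
theorem exists_mem_chart_range (p : W.scheme.left) : ∃ c : ChartIdx, p ∈ Set.range (W.chartLeft c.i) := by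
  rcases WeierstrassScheme.mem_range_infChart_or_affineChart W p with h | h
  · exact ⟨.inf, by rw [range_chartLeft]; exact h⟩
  · exact ⟨.aff, by rw [range_chartLeft]; exact h⟩

/-- **The open cover of `E_W` by the two hypersurface charts** (indexed by `ChartIdx`).
[cite: SilvermanAEC2009, III.1] -/
def chartCover : W.scheme.left.OpenCover :=
  Scheme.Cover.mkOfCovers ChartIdx (fun c => Spec (.of (W.chartRing c.i))) (fun c => W.chartLeft c.i) fun p => by
    obtain ⟨c, y, hy⟩ := W.exists_mem_chart_range p
    exact ⟨c, y, hy⟩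

/-- The components of `chartCover` are the charts (`rfl`). [folklore] -/
@[simp]
theorem chartCover_f (c : ChartIdx) : W.chartCover.f c = W.chartLeft c.i := rfl

end WeierstrassCurve
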